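import Literature.NumberTheory.Transcendental.LinGroupZEBezout
import Mathlib.LinearAlgebra.JordanChevalley
import Mathlib.LinearAlgebra.Eigenspace.Minpoly
import Mathlib.FieldTheory.Separable
import Mathlib.RingTheory.Adjoin.Polynomial.Basic
import Mathlib.RingTheory.RootsOfUnity.Basic
import Mathlib.Algebra.Polynomial.Roots
import HarnessLib

/-!
# Closed subgroups of `G = 𝔾ₐ^{d₀} × 𝔾ₘ^{d₁}`: Jordan decomposition, identity component, characters

Topic `Literature/NumberTheory/Transcendental`. Third module of the port of the tree's proof of
Philippon's zero estimate with multiplicities from `𝔾ₐ × 𝔾ₘⁿ` (`GaGmSubgroups.lean`) to the linear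
group `𝔾ₐ^{d₀} × 𝔾ₘ^{d₁}` (`LinGroup d₀ d₁`), owed to `Literature.Barriers.Schanuel.roy1992_thm1`
(Roy 1992 Thm 1 = Waldschmidt 1988 Thm 4.1). The group-theoretic input for the descent: the
obstruction subgroup produced by the descent is an abstract closed irreducible subgroup
`H₀ ≤ ℂ^{d₀} × (ℂˣ)^{d₁}`, and this file identifies it with a `LinGroup.ConnAlgSubgroup`
(`E × T_A`, `LinGroup.lean`). Everything is PROVED (Borel, *Linear Algebraic Groups*, §§1.2, 4.4,
8.2–8.5 for `𝔾ₐ^{d₀} × 𝔾ₘ^{d₁}`, by elementary means). The only point where `d₀ > 1` needs a new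
argument is the additive part: the additive points `(x, 1)` of a closed subgroup form a VECTOR
SUBSPACE `E ⊆ ℂ^{d₀}` (`LinGroup.addSubspace`; for `d₀ = 1` this is the dichotomy `E ∈ {0, ℂ}` of
`GaGm.addPart_dichotomy`): the Zariski closure of `ℤx` contains the line `ℂx`.

* Translation operators `LinGroup.shiftOp g t` on the box pieces `Box 1 1 t`; torus translations
  are **semisimple** (diagonal on monomials, `isSemisimple_shiftOp_torus`), additive translations
  are **unipotent** (`isNilpotent_shiftOp_add_sub_one`, one coordinate at a time and commuting
  products); by Mathlib's Jordan–Chevalley decomposition the torus part of the translation by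
  `g ∈ H` is a polynomial in it, hence preserves `𝔍(H)`: **`torusPart_mem`** — `(a, y) ∈ H` closed
  `⟹ (0, y) ∈ H`.
* Closed subgroups `H ≤ G(ℂ)`: translations by `H` permute the components (`smul_comp_eq_comp`),
  the components are pairwise disjoint (`comps_disjoint`), the **identity component**
  `LinGroup.idComp H hH` is a closed irreducible subgroup and `H` is a finite union of its cosets
  (`exists_finset_eq_biUnion_smul_idComp`).
* Characters: `LinGroup.charGroup X ≤ ℤ^{d₁}`, monomial characters `monChar`, `evalAt_eq_sum`; the
  **additive part** `LinGroup.addSubspace H hH` of a closed subgroup is a `ℂ`-subspace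
  (`smul_mem_of_add_mem`); **duality for closed subgroups** (`mem_of_charGroup`); **saturation**
  of `charGroup H` for irreducible `H` (`charGroup_saturated`).
* **Structure theorem** (`toConnAlgSubgroup`, `toSubgroup_toConnAlgSubgroup`): an irreducible
  closed subgroup `H` is the group of points of the connected algebraic subgroup `E × T_A`,
  `E = addSubspace H`, `A = charGroup H`.

## References

* A. Borel, *Linear Algebraic Groups*, 2nd ed., GTM 126 (1991), §1.2, Thm 4.4, §8.2–8.5.
* Yu. V. Nesterenko, P. Philippon (eds.), LNM 1752 (2001), Ch. 11 (D. Roy), §2.1, §4.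
  [NesterenkoPhilippon2001]
* P. Philippon, Bull. Soc. Math. France 114 (1986), 355–383, §5. [Philippon1986]
* M. Waldschmidt, New Advances in Transcendence Theory (1988), 375–398, §7. [Waldschmidt1988]
-/

noncomputable section

open MvPolynomial
open scoped Pointwise

namespace Literature.NumberTheory.Transcendental

namespace LinGroup

variable {d₀ d₁ : ℕ}

/-! ### Translation operators on the box pieces -/

/-- The translation `P ↦ P(g·)` as an endomorphism of the finite-dimensional space
`Box 1 1 t` (all partial degrees `≤ t`). [folklore] -/
def shiftOp (g : LinGroup d₀ d₁) (t : ℕ) : Module.End ℂ ↥(Box (d₀ := d₀) (d₁ := d₁) 1 1 t) :=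
  (shift g).toLinearMap.restrict (p := Box 1 1 t) (q := Box 1 1 t) fun _ hx => shift_mem_Box g hx

/-- Unfolding `shiftOp`. [folklore] -/
@[simp] theorem shiftOp_apply_coe (g : LinGroup d₀ d₁) (t : ℕ) (v : ↥(Box (d₀ := d₀) (d₁ := d₁) 1 1 t)) :
    ((shiftOp g t v : ↥(Box (d₀ := d₀) (d₁ := d₁) 1 1 t)) : MvPolynomial (Fin d₀ ⊕ Fin d₁) ℂ) =
      shift g (v : MvPolynomial (Fin d₀ ⊕ Fin d₁) ℂ) :=
  rfl

/-- `shiftOp (gh) = shiftOp h ∘ shiftOp g`. [folklore] -/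
theorem shiftOp_mul (g h : LinGroup d₀ d₁) (t : ℕ) :
    shiftOp (d₀ := d₀) (d₁ := d₁) (g * h) t = shiftOp h t * shiftOp g t := by
  ext v
  simp only [shiftOp_apply_coe, Module.End.mul_apply, shift_mul, AlgHom.comp_apply]

/-- `shiftOp e = 1`. [folklore] -/
theorem shiftOp_one (t : ℕ) : shiftOp (d₀ := d₀) (d₁ := d₁) 1 t = 1 := by
  ext v
  simp [shiftOp_apply_coe, shift_one]

/-- Translation operators commute. [folklore] -/
theorem shiftOp_comm (g h : LinGroup d₀ d₁) (t : ℕ) :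
    shiftOp (d₀ := d₀) (d₁ := d₁) g t * shiftOp h t = shiftOp h t * shiftOp g t := by
  rw [← shiftOp_mul, ← shiftOp_mul, mul_comm]

/-! ### Torus translations are semisimple -/

/-- The value of the monomial `Y^{s'}` at `y ∈ (ℂˣ)^{d₁}` (`s'` the torus part of the exponent `s`).
[folklore] -/
def charVal (y : Fin d₁ → ℂˣ) (s : (Fin d₀ ⊕ Fin d₁) →₀ ℕ) : ℂ := ∏ l : Fin d₁, ((y l : ℂˣ) : ℂ) ^ s (Sum.inr l)

/-- Torus translations act diagonally on monomials: `Y ↦ yY` maps `X^{s₀}Y^{s'}` to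
`y^{s'} · X^{s₀}Y^{s'}`. [folklore] -/
theorem shift_torus_monomial (y : Fin d₁ → ℂˣ) (s : (Fin d₀ ⊕ Fin d₁) →₀ ℕ) (c : ℂ) :
    shift ((1 : Multiplicative (Fin d₀ → ℂ)), y) (monomial s c) = charVal (d₀ := d₀) y s • monomial s c := by
  classical
  rw [MvPolynomial.smul_monomial, shift, aeval_monomial, monomial_eq,
    Finsupp.prod_fintype _ _ (fun i => by simp), Finsupp.prod_fintype _ _ (fun i => by simp),
    Fintype.prod_sum_type, Fintype.prod_sum_type]
  simp only [shiftSubst_inl, shiftSubst_inr, toAdd_one, Pi.zero_apply, map_zero, add_zero, mul_pow,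
    ← map_pow, Finset.prod_mul_distrib, ← map_prod, MvPolynomial.algebraMap_eq, charVal, smul_eq_mul]
  rw [map_mul]
  ring

/-- A box polynomial is the sum of its monomials, inside the box piece. [folklore] -/
theorem eq_sum_monomial_Box {D₀ D₁ t : ℕ} (v : ↥(Box (d₀ := d₀) (d₁ := d₁) D₀ D₁ t)) :
    ∃ (hmem : ∀ s ∈ (v : MvPolynomial (Fin d₀ ⊕ Fin d₁) ℂ).support,
      (monomial s ((v : MvPolynomial (Fin d₀ ⊕ Fin d₁) ℂ).coeff s) : MvPolynomial (Fin d₀ ⊕ Fin d₁) ℂ) ∈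
        Box (d₀ := d₀) (d₁ := d₁) D₀ D₁ t),
      v = ∑ s ∈ (v : MvPolynomial (Fin d₀ ⊕ Fin d₁) ℂ).support.attach,
        (⟨monomial s.1 ((v : MvPolynomial (Fin d₀ ⊕ Fin d₁) ℂ).coeff s.1), hmem s.1 s.2⟩ :
          ↥(Box (d₀ := d₀) (d₁ := d₁) D₀ D₁ t)) := by
  have hsupp : (((v : MvPolynomial (Fin d₀ ⊕ Fin d₁) ℂ).support : Finset ((Fin d₀ ⊕ Fin d₁) →₀ ℕ)) :
      Set ((Fin d₀ ⊕ Fin d₁) →₀ ℕ)) ⊆ boxSet D₀ D₁ t := (mem_restrictSupport_iff ℂ).mp v.2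
  refine ⟨fun s hs => (monomial_mem_restrictSupport ℂ).mpr (Or.inl (hsupp hs)), ?_⟩
  apply Subtype.ext
  rw [Submodule.coe_sum]
  conv_lhs => rw [(v : MvPolynomial (Fin d₀ ⊕ Fin d₁) ℂ).as_sum]
  exact (Finset.sum_attach _ _).symm

/-- **Torus translations are semisimple** on every box piece (diagonal in the monomial basis).
[folklore] -/
theorem isSemisimple_shiftOp_torus (y : Fin d₁ → ℂˣ) (t : ℕ) :
    (shiftOp (d₀ := d₀) (d₁ := d₁) ((1 : Multiplicative (Fin d₀ → ℂ)), y) t).IsSemisimple := by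
  classical
  haveI : Finite ↥(boxSet (d₀ := d₀) (d₁ := d₁) 1 1 t) := Finite.of_equiv _ (boxSetEquiv 1 1 t).symm
  haveI : Fintype ↥(boxSet (d₀ := d₀) (d₁ := d₁) 1 1 t) := Fintype.ofFinite _
  -- the annihilating square-free polynomial `∏_{μ ∈ eigenvalues} (X - μ)`
  set E : Finset ℂ := Finset.univ.image (fun s : ↥(boxSet (d₀ := d₀) (d₁ := d₁) 1 1 t) => charVal (d₀ := d₀) y s.1)
    with hE
  set p : Polynomial ℂ := ∏ μ ∈ E, (Polynomial.X - Polynomial.C μ) with hp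
  have hsq : Squarefree p := by
    refine Polynomial.Separable.squarefree ?_
    rw [hp, Polynomial.separable_prod_X_sub_C_iff']
    exact Set.injOn_id _
  refine Module.End.isSemisimple_of_squarefree_aeval_eq_zero hsq ?_
  -- `aeval T p` kills every box polynomial, monomial by monomial
  refine LinearMap.ext fun v => ?_
  obtain ⟨hmem, hv⟩ := eq_sum_monomial_Box v
  rw [hv, map_sum, LinearMap.zero_apply]
  refine Finset.sum_eq_zero fun s _ => ?_
  have hs : s.1 ∈ boxSet (d₀ := d₀) (d₁ := d₁) 1 1 t := (mem_restrictSupport_iff ℂ).mp v.2 s.2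
  have hc : (v : MvPolynomial (Fin d₀ ⊕ Fin d₁) ℂ).coeff s.1 ≠ 0 := mem_support_iff.mp s.2
  have hev : (shiftOp (d₀ := d₀) (d₁ := d₁) ((1 : Multiplicative (Fin d₀ → ℂ)), y) t).HasEigenvector
      (charVal (d₀ := d₀) y s.1)
      ⟨monomial s.1 ((v : MvPolynomial (Fin d₀ ⊕ Fin d₁) ℂ).coeff s.1), hmem s.1 s.2⟩ := by
    refine ⟨Module.End.mem_eigenspace_iff.mpr ?_, fun h => ?_⟩
    · apply Subtype.ext
      rw [shiftOp_apply_coe, Submodule.coe_smul, shift_torus_monomial]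
    · have := congrArg Subtype.val h
      simp only [Submodule.coe_zero, monomial_eq_zero] at this
      exact hc this
  rw [Module.End.aeval_apply_of_hasEigenvector hev]
  have : p.eval (charVal (d₀ := d₀) y s.1) = 0 := by
    rw [hp, Polynomial.eval_prod]
    exact Finset.prod_eq_zero (Finset.mem_image_of_mem _
      (Finset.mem_univ (⟨s.1, hs⟩ : ↥(boxSet (d₀ := d₀) (d₁ := d₁) 1 1 t)))) (by simp)
  rw [this, zero_smul]

/-! ### Additive translations are unipotent -/

/-- The additive translation by `a eᵢ` (one coordinate). [folklore] -/
def addElt (i : Fin d₀) (a : ℂ) : LinGroup d₀ d₁ :=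
  (Multiplicative.ofAdd (Pi.single i a), (1 : Fin d₁ → ℂˣ))

/-- The substitution of `addElt i a` off the variable `X_i` is the identity. [folklore] -/
theorem shiftSubst_addElt_of_ne (i : Fin d₀) (a : ℂ) {v : Fin d₀ ⊕ Fin d₁} (hv : v ≠ Sum.inl i) :
    shiftSubst (addElt (d₁ := d₁) i a) v = X v := by
  rcases v with j | l
  · have hji : j ≠ i := fun h => hv (by rw [h])
    simp [addElt, Pi.single_eq_of_ne hji]
  · simp [addElt]

/-- The substitution of `addElt i a` on `X_i`. [folklore] -/
theorem shiftSubst_addElt_self (i : Fin d₀) (a : ℂ) :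
    shiftSubst (addElt (d₁ := d₁) i a) (Sum.inl i) = X (Sum.inl i) + C a := by
  simp [addElt]

/-- A monomial with the variable `X_i` split off. [folklore] -/
theorem monomial_eq_erase (i : Fin d₀) (s : (Fin d₀ ⊕ Fin d₁) →₀ ℕ) (c : ℂ) :
    (monomial s c : MvPolynomial (Fin d₀ ⊕ Fin d₁) ℂ) =
      (C c * ∏ v ∈ Finset.univ.erase (Sum.inl i), X v ^ s v) * X (Sum.inl i) ^ s (Sum.inl i) := by
  classical
  rw [monomial_eq, Finsupp.prod_fintype _ _ (fun i => by simp),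
    ← Finset.mul_prod_erase _ _ (Finset.mem_univ (Sum.inl i))]
  ring

/-- The translate of a monomial by `a eᵢ`, with the variable `X_i` split off. [folklore] -/
theorem shift_addElt_monomial (i : Fin d₀) (a : ℂ) (s : (Fin d₀ ⊕ Fin d₁) →₀ ℕ) (c : ℂ) :
    shift (addElt (d₁ := d₁) i a) (monomial s c) =
      (C c * ∏ v ∈ Finset.univ.erase (Sum.inl i), X v ^ s v) * (X (Sum.inl i) + C a) ^ s (Sum.inl i) := by
  classical
  rw [shift, aeval_monomial, Finsupp.prod_fintype _ _ (fun i => by simp),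
    ← Finset.mul_prod_erase _ _ (Finset.mem_univ (Sum.inl i)), shiftSubst_addElt_self,
    MvPolynomial.algebraMap_eq]
  have h : ∏ v ∈ Finset.univ.erase (Sum.inl i), shiftSubst (addElt (d₁ := d₁) i a) v ^ s v =
      ∏ v ∈ Finset.univ.erase (Sum.inl i), (X v : MvPolynomial (Fin d₀ ⊕ Fin d₁) ℂ) ^ s v := by
    refine Finset.prod_congr rfl fun v hv => ?_
    rw [shiftSubst_addElt_of_ne i a (Finset.ne_of_mem_erase hv)]
  rw [h]
  ring

/-- `(X_i + a)^k - X_i^k` has `X_i`-degree `< k`. [folklore] -/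
theorem degreeOf_X_add_C_pow_sub_le (i : Fin d₀) (a : ℂ) (k : ℕ) :
    (((X (Sum.inl i) + C a) ^ k - X (Sum.inl i) ^ k : MvPolynomial (Fin d₀ ⊕ Fin d₁) ℂ)).degreeOf (Sum.inl i) ≤
      k - 1 := by
  classical
  rw [add_pow, Finset.sum_range_succ]
  simp only [Nat.sub_self, pow_zero, mul_one, Nat.choose_self, Nat.cast_one, add_sub_cancel_right]
  refine (degreeOf_sum_le _ _ _).trans (Finset.sup_le fun j hj => ?_)
  rw [Finset.mem_range] at hj
  have h1 : ((X (Sum.inl i) : MvPolynomial (Fin d₀ ⊕ Fin d₁) ℂ) ^ j).degreeOf (Sum.inl i) ≤ j := by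
    refine (degreeOf_pow_le _ _ _).trans ?_
    rw [degreeOf_X, if_pos rfl, mul_one]
  have h2 : ((C a : MvPolynomial (Fin d₀ ⊕ Fin d₁) ℂ) ^ (k - j)).degreeOf (Sum.inl i) = 0 := by
    rw [← map_pow, degreeOf_C]
  have h3 : ((k.choose j : ℕ) : MvPolynomial (Fin d₀ ⊕ Fin d₁) ℂ).degreeOf (Sum.inl i) = 0 := by
    rw [← map_natCast C, degreeOf_C]
  have h4 := degreeOf_mul_le (Sum.inl i) ((X (Sum.inl i) : MvPolynomial (Fin d₀ ⊕ Fin d₁) ℂ) ^ j)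
    ((C a : MvPolynomial (Fin d₀ ⊕ Fin d₁) ℂ) ^ (k - j))
  have h5 := degreeOf_mul_le (Sum.inl i) ((X (Sum.inl i) : MvPolynomial (Fin d₀ ⊕ Fin d₁) ℂ) ^ j * (C a) ^ (k - j))
    ((k.choose j : ℕ) : MvPolynomial (Fin d₀ ⊕ Fin d₁) ℂ)
  omega

/-- The `X_i`-degree of the cofactor `c · ∏_{v ≠ X_i} v^{s_v}` vanishes. [folklore] -/
theorem degreeOf_cofactor_eq_zero (i : Fin d₀) (s : (Fin d₀ ⊕ Fin d₁) →₀ ℕ) (c : ℂ) :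
    (C c * ∏ v ∈ Finset.univ.erase (Sum.inl i), X v ^ s v : MvPolynomial (Fin d₀ ⊕ Fin d₁) ℂ).degreeOf
      (Sum.inl i) = 0 := by
  classical
  refine Nat.eq_zero_of_le_zero ((degreeOf_C_mul_le _ _ _).trans ?_)
  refine (degreeOf_prod_le _ _ _).trans (le_of_eq (Finset.sum_eq_zero fun v hv => ?_))
  refine Nat.eq_zero_of_le_zero ((degreeOf_pow_le _ _ _).trans ?_)
  rw [degreeOf_X, if_neg (Finset.ne_of_mem_erase hv).symm, mul_zero]

/-- The additive translation by `a eᵢ` minus the identity lowers the `X_i`-degree: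
`deg_{X_i} (P(X + a eᵢ, Y) - P) ≤ deg_{X_i} P - 1`. [folklore] -/
theorem degreeOf_shift_addElt_sub_le (i : Fin d₀) (a : ℂ) (P : MvPolynomial (Fin d₀ ⊕ Fin d₁) ℂ) :
    (shift (addElt (d₁ := d₁) i a) P - P).degreeOf (Sum.inl i) ≤ P.degreeOf (Sum.inl i) - 1 := by
  classical
  -- monomial by monomial
  have hmon : ∀ (s : (Fin d₀ ⊕ Fin d₁) →₀ ℕ) (c : ℂ),
      (shift (addElt (d₁ := d₁) i a) (monomial s c) - monomial s c).degreeOf (Sum.inl i) ≤ s (Sum.inl i) - 1 := by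
    intro s c
    have e : shift (addElt (d₁ := d₁) i a) (monomial s c) - monomial s c =
        (C c * ∏ v ∈ Finset.univ.erase (Sum.inl i), X v ^ s v) *
          ((X (Sum.inl i) + C a) ^ s (Sum.inl i) - X (Sum.inl i) ^ s (Sum.inl i)) := by
      rw [shift_addElt_monomial, monomial_eq_erase i s c]
      ring
    rw [e]
    refine (degreeOf_mul_le _ _ _).trans ?_
    rw [degreeOf_cofactor_eq_zero, zero_add]
    exact degreeOf_X_add_C_pow_sub_le i a (s (Sum.inl i))
  conv_lhs => rw [P.as_sum, map_sum, ← Finset.sum_sub_distrib]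
  refine (degreeOf_sum_le _ _ _).trans (Finset.sup_le fun s hs => (hmon s _).trans ?_)
  exact Nat.sub_le_sub_right (monomial_le_degreeOf (Sum.inl i) hs) 1

/-- Polynomials of `X_i`-degree zero are fixed by the additive translations `a eᵢ`. [folklore] -/
theorem shift_addElt_eq_self_of_degreeOf_eq_zero (i : Fin d₀) (a : ℂ) {P : MvPolynomial (Fin d₀ ⊕ Fin d₁) ℂ}
    (hP : P.degreeOf (Sum.inl i) = 0) : shift (addElt (d₁ := d₁) i a) P = P := by
  classical
  conv_lhs => rw [P.as_sum, map_sum]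
  conv_rhs => rw [P.as_sum]
  refine Finset.sum_congr rfl fun s hs => ?_
  have hs0 : s (Sum.inl i) = 0 := by
    have := monomial_le_degreeOf (Sum.inl i) hs; rw [hP] at this; exact Nat.eq_zero_of_le_zero this
  rw [shift_addElt_monomial, hs0, pow_zero]
  conv_rhs => rw [monomial_eq_erase i s, hs0, pow_zero]

/-- The additive translations `a eᵢ` are unipotent on every box piece:
`(shift (a eᵢ, 1) - 1)^{t+1} = 0` on `Box 1 1 t`. [folklore] -/
theorem isNilpotent_shiftOp_addElt_sub_one (i : Fin d₀) (a : ℂ) (t : ℕ) :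
    IsNilpotent (shiftOp (addElt (d₁ := d₁) i a) t - 1) := by
  set N := shiftOp (addElt (d₁ := d₁) i a) t - 1 with hN
  have hNapply : ∀ v : ↥(Box (d₀ := d₀) (d₁ := d₁) 1 1 t),
      ((N v : ↥(Box (d₀ := d₀) (d₁ := d₁) 1 1 t)) : MvPolynomial (Fin d₀ ⊕ Fin d₁) ℂ) =
      shift (addElt (d₁ := d₁) i a) (v : MvPolynomial (Fin d₀ ⊕ Fin d₁) ℂ) - v := fun v => rfl
  -- `N^k` lowers the `X_i`-degree by `k`
  have hdeg : ∀ (k : ℕ) (v : ↥(Box (d₀ := d₀) (d₁ := d₁) 1 1 t)),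
      (((N ^ k) v : ↥(Box (d₀ := d₀) (d₁ := d₁) 1 1 t)) : MvPolynomial (Fin d₀ ⊕ Fin d₁) ℂ).degreeOf (Sum.inl i) ≤
        t - k := by
    intro k
    induction k with
    | zero =>
      intro v
      have := (mem_Box_iff.mp v.2) (Sum.inl i)
      simpa using this
    | succ k ih =>
      intro v
      rw [pow_succ', Module.End.mul_apply, hNapply]
      exact (degreeOf_shift_addElt_sub_le i a _).trans (by have := ih v; omega)
  refine ⟨t + 1, LinearMap.ext fun v => Subtype.ext ?_⟩
  rw [pow_succ', Module.End.mul_apply, hNapply, LinearMap.zero_apply, Submodule.coe_zero,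
    shift_addElt_eq_self_of_degreeOf_eq_zero i a (Nat.eq_zero_of_le_zero (by simpa using hdeg t v)), sub_self]

/-- **Additive translations are unipotent** on every box piece: `shift (a, 1) - 1` is nilpotent on
`Box 1 1 t` (a commuting product of the unipotent one-coordinate translations). [folklore] -/
theorem isNilpotent_shiftOp_add_sub_one (a : Fin d₀ → ℂ) (t : ℕ) :
    IsNilpotent (shiftOp (Multiplicative.ofAdd a, (1 : Fin d₁ → ℂˣ)) t - 1) := by
  classical
  -- by induction on the set of coordinates switched on
  suffices h : ∀ I : Finset (Fin d₀),
      IsNilpotent (shiftOp (Multiplicative.ofAdd (∑ i ∈ I, Pi.single i (a i)), (1 : Fin d₁ → ℂˣ)) t - 1) by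
    have := h Finset.univ
    rwa [Finset.univ_sum_single] at this
  intro I
  induction I using Finset.induction_on with
  | empty =>
    rw [Finset.sum_empty, ofAdd_zero]
    refine ⟨1, ?_⟩
    rw [pow_one]
    refine LinearMap.ext fun v => ?_
    change shiftOp (1 : LinGroup d₀ d₁) t v - v = 0
    rw [shiftOp_one, Module.End.one_apply, sub_self]
  | insert j I hj ih =>
    rw [Finset.sum_insert hj, ofAdd_add]
    have hsplit : ((Multiplicative.ofAdd (Pi.single j (a j)) * Multiplicative.ofAdd (∑ i ∈ I, Pi.single i (a i)),
        (1 : Fin d₁ → ℂˣ)) : LinGroup d₀ d₁) =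
        addElt j (a j) * (Multiplicative.ofAdd (∑ i ∈ I, Pi.single i (a i)), (1 : Fin d₁ → ℂˣ)) := by
      rw [addElt, Prod.mk_mul_mk, mul_one]
    rw [hsplit, shiftOp_mul]
    set U := shiftOp (Multiplicative.ofAdd (∑ i ∈ I, Pi.single i (a i)), (1 : Fin d₁ → ℂˣ)) t with hU
    set V := shiftOp (addElt (d₁ := d₁) j (a j)) t with hV
    have hUV : Commute U V := shiftOp_comm _ _ t
    have hVU : ∀ w, V (U w) = U (V w) := fun w => by
      have h1 := congrArg (fun f : Module.End ℂ ↥(Box (d₀ := d₀) (d₁ := d₁) 1 1 t) => f w) hUV.eq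
      simpa only [Module.End.mul_apply] using h1.symm
    have e : U * V - 1 = U * (V - 1) + (U - 1) := by
      refine LinearMap.ext fun v => ?_
      simp only [Module.End.mul_apply, LinearMap.add_apply, LinearMap.sub_apply, Module.End.one_apply, map_sub]
      abel
    rw [e]
    have hV1 : IsNilpotent (V - 1) := isNilpotent_shiftOp_addElt_sub_one j (a j) t
    have hc1 : Commute U (V - 1) := by
      change U * (V - 1) = (V - 1) * U
      refine LinearMap.ext fun v => ?_
      simp only [Module.End.mul_apply, LinearMap.sub_apply, Module.End.one_apply, map_sub, hVU]
    have hc2 : Commute (U * (V - 1)) (U - 1) := by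
      change U * (V - 1) * (U - 1) = (U - 1) * (U * (V - 1))
      refine LinearMap.ext fun v => ?_
      simp only [Module.End.mul_apply, LinearMap.sub_apply, Module.End.one_apply, map_sub, hVU]
      abel
    exact hc2.isNilpotent_add (hc1.isNilpotent_mul_left hV1) ih

/-! ### The Jordan decomposition of a translation: torus parts of elements stay in closed subgroups -/

/-- Polynomials in an operator preserve its invariant subspaces. [folklore] -/
theorem aeval_apply_mem_of_forall_mem {V : Type*} [AddCommGroup V] [Module ℂ V] (T : Module.End ℂ V)
    (U : Submodule ℂ V) (hU : ∀ u ∈ U, T u ∈ U) (q : Polynomial ℂ) {u : V} (hu : u ∈ U) :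
    Polynomial.aeval T q u ∈ U := by
  induction q using Polynomial.induction_on generalizing u with
  | C c => simpa [Module.algebraMap_end_apply] using U.smul_mem c hu
  | add p q hp hq => rw [map_add, LinearMap.add_apply]; exact U.add_mem (hp hu) (hq hu)
  | monomial k c ih =>
    rw [pow_succ, ← mul_assoc, map_mul, Module.End.mul_apply, Polynomial.aeval_X]
    exact ih (hU u hu)

/-- **The torus part of an element of a closed subgroup lies in the subgroup** (the semisimple
part of the translation operator is a polynomial in it — Jordan–Chevalley — hence preserves
the ideal of the subgroup; Borel, *Linear Algebraic Groups*, Thm 4.4). For `H ≤ ℂ^{d₀} × (ℂˣ)^{d₁}`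
closed and `(a, y) ∈ H`: `(0, y) ∈ H`. [folklore] -/
theorem torusPart_mem (H : Subgroup (LinGroup d₀ d₁)) (hH : IsClosedG (H : Set (LinGroup d₀ d₁))) {g : LinGroup d₀ d₁}
    (hg : g ∈ H) : ((1 : Multiplicative (Fin d₀ → ℂ)), g.2) ∈ H := by
  classical
  -- it suffices that every `P ∈ 𝔍(H)` vanishes at `(0, y)`
  suffices h : ∀ P ∈ vanishing (H : Set (LinGroup d₀ d₁)), evalAt P ((1 : Multiplicative (Fin d₀ → ℂ)), g.2) = 0 by
    have : ((1 : Multiplicative (Fin d₀ → ℂ)), g.2) ∈ zeroSet (d₀ := d₀) (d₁ := d₁) ↑(vanishing (H : Set (LinGroup d₀ d₁))) :=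
      fun P hP => h P hP
    rw [hH.eq] at this
    exact this
  intro P hP
  set t := P.totalDegree with ht
  have hPB : P ∈ Box (d₀ := d₀) (d₁ := d₁) 1 1 t := mem_Box_totalDegree le_rfl le_rfl P
  -- the three operators on `Box 1 1 t`
  set gs : LinGroup d₀ d₁ := ((1 : Multiplicative (Fin d₀ → ℂ)), g.2) with hgs
  set gu : LinGroup d₀ d₁ := (g.1, (1 : Fin d₁ → ℂˣ)) with hgu
  have hgg : g = gu * gs := by ext <;> simp [gu, gs]
  set T := shiftOp (d₀ := d₀) (d₁ := d₁) g t with hT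
  set Ts := shiftOp (d₀ := d₀) (d₁ := d₁) gs t with hTs
  set N := shiftOp (d₀ := d₀) (d₁ := d₁) gu t - 1 with hN
  have hTeq : T = Ts * N + Ts := by
    rw [hT, hgg, shiftOp_mul]
    change Ts * shiftOp gu t = Ts * (shiftOp gu t - 1) + Ts
    refine LinearMap.ext fun v => ?_
    simp only [Module.End.mul_apply, LinearMap.add_apply, LinearMap.sub_apply, Module.End.one_apply, map_sub,
      sub_add_cancel]
  have hNil : IsNilpotent N := by
    have := isNilpotent_shiftOp_add_sub_one (d₀ := d₀) (d₁ := d₁) (Multiplicative.toAdd g.1) t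
    simpa [gu] using this
  have hSs : Ts.IsSemisimple := isSemisimple_shiftOp_torus g.2 t
  have hcomm : Commute Ts N := by
    change Ts * N = N * Ts
    rw [hN]
    refine LinearMap.ext fun v => ?_
    have h1 := congrArg (fun f : Module.End ℂ ↥(Box (d₀ := d₀) (d₁ := d₁) 1 1 t) => f v) (shiftOp_comm gs gu t)
    simp only [Module.End.mul_apply] at h1
    simp only [Module.End.mul_apply, LinearMap.sub_apply, Module.End.one_apply, map_sub]
    change Ts (shiftOp gu t v) - Ts v = shiftOp gu t (Ts v) - Ts v
    rw [h1]
  have hn₁ : IsNilpotent (Ts * N) := hcomm.isNilpotent_mul_left hNil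
  have hc₁ : Commute (Ts * N) Ts := Commute.mul_left (Commute.refl Ts) hcomm.symm
  -- Jordan–Chevalley for `T`
  obtain ⟨n₀, hn₀, s₀, hs₀, hn₀nil, hs₀ss, hT0⟩ := Module.End.exists_isNilpotent_isSemisimple (f := T)
  have hc₀ : Commute n₀ s₀ := by
    rw [Algebra.adjoin_singleton_eq_range_aeval] at hn₀ hs₀
    obtain ⟨q₁, rfl⟩ := hn₀
    obtain ⟨q₂, rfl⟩ := hs₀
    change Polynomial.aeval T q₁ * Polynomial.aeval T q₂ = Polynomial.aeval T q₂ * Polynomial.aeval T q₁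
    rw [← map_mul, ← map_mul, mul_comm]
  have huniq := Module.End.isNilpotent_isSemisimple_unique hn₁ hSs hn₀nil hs₀ss hc₁ hc₀ (by rw [← hTeq, hT0])
  -- so `Ts` is a polynomial in `T`, hence preserves `𝔍(H) ∩ Box`
  have hTs_mem : Ts ∈ Algebra.adjoin ℂ {T} := huniq.2 ▸ hs₀
  rw [Algebra.adjoin_singleton_eq_range_aeval] at hTs_mem
  obtain ⟨q, hq⟩ := hTs_mem
  let U : Submodule ℂ ↥(Box (d₀ := d₀) (d₁ := d₁) 1 1 t) :=
    ((vanishing (H : Set (LinGroup d₀ d₁))).restrictScalars ℂ).comap (Box (d₀ := d₀) (d₁ := d₁) 1 1 t).subtype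
  have hU : ∀ u ∈ U, T u ∈ U := by
    intro u hu
    change shift g (u : MvPolynomial (Fin d₀ ⊕ Fin d₁) ℂ) ∈ vanishing (H : Set (LinGroup d₀ d₁))
    intro h hh
    rw [evalAt_shift]
    exact hu (g * h) (H.mul_mem hg hh)
  have hmem : Ts ⟨P, hPB⟩ ∈ U := by
    rw [← hq]
    exact aeval_apply_mem_of_forall_mem T U hU q (show (⟨P, hPB⟩ : ↥(Box (d₀ := d₀) (d₁ := d₁) 1 1 t)) ∈ U from hP)
  -- evaluate at the identity
  have h1 : evalAt (shift gs P) 1 = 0 := hmem 1 H.one_mem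
  rwa [evalAt_shift, mul_one] at h1

/-! ### Closed subgroups: components are the cosets of the identity component -/

section ClosedSubgroup

variable (H : Subgroup (LinGroup d₀ d₁)) (hH : IsClosedG (H : Set (LinGroup d₀ d₁)))
include hH

/-- Translations by elements of a closed subgroup permute its components. [folklore] -/
theorem smul_comp_eq_comp {𝔮 : Ideal (MvPolynomial (Fin d₀ ⊕ Fin d₁) ℂ)} (h𝔮 : 𝔮 ∈ comps (H : Set (LinGroup d₀ d₁)))
    {h : LinGroup d₀ d₁} (hh : h ∈ H) :
    ∃ 𝔮' ∈ comps (H : Set (LinGroup d₀ d₁)), h • zeroSetI (d₀ := d₀) (d₁ := d₁) 𝔮 = zeroSetI 𝔮' := by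
  rw [mem_comps] at h𝔮
  obtain ⟨hirr, hv, hsub⟩ := isIrred_zeroSet_of_mem_minimalPrimes h𝔮
  rw [hH.eq] at hsub
  -- `h • C` is irreducible closed inside `H`, hence inside a component `C'`
  have hsubH : h • zeroSetI (d₀ := d₀) (d₁ := d₁) 𝔮 ⊆ (H : Set (LinGroup d₀ d₁)) := by
    rintro _ ⟨c, hc, rfl⟩
    exact H.mul_mem hh (hsub hc)
  obtain ⟨𝔮', h𝔮', hle⟩ := (hirr.smul h).exists_minimalPrimes_subset hsubH
  refine ⟨𝔮', (mem_comps).mpr h𝔮', Set.Subset.antisymm hle ?_⟩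
  -- conversely `C ⊆ h⁻¹ • C'`, an irreducible closed subset of `H`; so `C` is it
  obtain ⟨hirr', hv', hsub'⟩ := isIrred_zeroSet_of_mem_minimalPrimes h𝔮'
  rw [hH.eq] at hsub'
  have hsubH' : h⁻¹ • zeroSetI (d₀ := d₀) (d₁ := d₁) 𝔮' ⊆ (H : Set (LinGroup d₀ d₁)) := by
    rintro _ ⟨c, hc, rfl⟩
    exact H.mul_mem (H.inv_mem hh) (hsub' hc)
  obtain ⟨𝔮'', h𝔮'', hle'⟩ := (hirr'.smul h⁻¹).exists_minimalPrimes_subset hsubH'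
  have hC : zeroSetI (d₀ := d₀) (d₁ := d₁) 𝔮 ⊆ zeroSetI 𝔮'' := by
    refine le_trans ?_ hle'
    intro c hc
    exact Set.mem_inv_smul_set_iff.mpr (hle (Set.smul_mem_smul_set hc))
  have heq := eq_of_zeroSet_subset_of_mem_minimalPrimes h𝔮 h𝔮'' hC
  subst heq
  intro c hc
  have : h⁻¹ • c ∈ zeroSetI (d₀ := d₀) (d₁ := d₁) 𝔮 := hle' (Set.smul_mem_smul_set hc)
  have e : c = h • (h⁻¹ • c) := by rw [smul_smul, mul_inv_cancel, one_smul]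
  rw [e]
  exact Set.smul_mem_smul_set this

/-- The components of a closed subgroup are pairwise disjoint (the set of points lying on two
components is closed, translation invariant and does not contain whole components).
[folklore] -/
theorem comps_disjoint {𝔮₁ 𝔮₂ : Ideal (MvPolynomial (Fin d₀ ⊕ Fin d₁) ℂ)} (h𝔮₁ : 𝔮₁ ∈ comps (H : Set (LinGroup d₀ d₁)))
    (h𝔮₂ : 𝔮₂ ∈ comps (H : Set (LinGroup d₀ d₁))) (hne : 𝔮₁ ≠ 𝔮₂) :
    Disjoint (zeroSetI (d₀ := d₀) (d₁ := d₁) 𝔮₁) (zeroSetI 𝔮₂) := by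
  classical
  rw [Set.disjoint_iff]
  rintro x ⟨hx₁, hx₂⟩
  exfalso
  -- every `h ∈ H` lies on two distinct components
  set Pairs := ((comps (H : Set (LinGroup d₀ d₁))) ×ˢ (comps (H : Set (LinGroup d₀ d₁)))).filter (fun pq => pq.1 ≠ pq.2)
    with hPairs
  have hxH : x ∈ (H : Set (LinGroup d₀ d₁)) := by
    have := (isIrred_zeroSet_of_mem_minimalPrimes ((mem_comps).mp h𝔮₁)).2.2 hx₁
    rwa [hH.eq] at this
  have hcover : (H : Set (LinGroup d₀ d₁)) ⊆ ⋃ pq ∈ Pairs, (zeroSetI (d₀ := d₀) (d₁ := d₁) pq.1 ∩ zeroSetI pq.2) := by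
    intro h hh
    have hk : h * x⁻¹ ∈ H := H.mul_mem hh (H.inv_mem hxH)
    obtain ⟨𝔮₁', h𝔮₁', he₁⟩ := smul_comp_eq_comp H hH h𝔮₁ hk
    obtain ⟨𝔮₂', h𝔮₂', he₂⟩ := smul_comp_eq_comp H hH h𝔮₂ hk
    have hne' : 𝔮₁' ≠ 𝔮₂' := by
      intro heq
      apply hne
      have hZ : zeroSetI (d₀ := d₀) (d₁ := d₁) 𝔮₁ = zeroSetI 𝔮₂ := by
        have h1 : (h * x⁻¹) • zeroSetI (d₀ := d₀) (d₁ := d₁) 𝔮₁ = (h * x⁻¹) • zeroSetI 𝔮₂ := by rw [he₁, he₂, heq]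
        have h2 := congrArg (fun S : Set (LinGroup d₀ d₁) => (h * x⁻¹)⁻¹ • S) h1
        simpa only [inv_smul_smul] using h2
      exact eq_of_zeroSet_subset_of_mem_minimalPrimes ((mem_comps).mp h𝔮₁) ((mem_comps).mp h𝔮₂) hZ.le
    have hmem : ∀ 𝔮 : Ideal (MvPolynomial (Fin d₀ ⊕ Fin d₁) ℂ), x ∈ zeroSetI (d₀ := d₀) (d₁ := d₁) 𝔮 →
        h ∈ (h * x⁻¹) • zeroSetI (d₀ := d₀) (d₁ := d₁) 𝔮 := fun 𝔮 hx =>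
      ⟨x, hx, by simp [smul_eq_mul, mul_assoc]⟩
    rw [Set.mem_iUnion₂]
    refine ⟨(𝔮₁', 𝔮₂'), ?_, ?_⟩
    · rw [hPairs, Finset.mem_filter, Finset.mem_product]; exact ⟨⟨h𝔮₁', h𝔮₂'⟩, hne'⟩
    · exact ⟨he₁ ▸ hmem 𝔮₁ hx₁, he₂ ▸ hmem 𝔮₂ hx₂⟩
  -- the component through `x` lies in one of these proper intersections: contradiction
  obtain ⟨hirr, -, hsub⟩ := isIrred_zeroSet_of_mem_minimalPrimes ((mem_comps).mp h𝔮₁)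
  rw [hH.eq] at hsub
  obtain ⟨pq, hpq, hle⟩ := hirr.exists_subset_of_subset_biUnion Pairs _
    (fun pq hpq => by
      rw [hPairs, Finset.mem_filter, Finset.mem_product] at hpq
      exact (isIrred_zeroSet_of_mem_minimalPrimes ((mem_comps).mp hpq.1.1)).1.isClosedG.inter
        (isIrred_zeroSet_of_mem_minimalPrimes ((mem_comps).mp hpq.1.2)).1.isClosedG)
    (hsub.trans hcover)
  rw [hPairs, Finset.mem_filter, Finset.mem_product] at hpq
  have e1 := eq_of_zeroSet_subset_of_mem_minimalPrimes ((mem_comps).mp h𝔮₁) ((mem_comps).mp hpq.1.1)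
    (hle.trans Set.inter_subset_left)
  have e2 := eq_of_zeroSet_subset_of_mem_minimalPrimes ((mem_comps).mp h𝔮₁) ((mem_comps).mp hpq.1.2)
    (hle.trans Set.inter_subset_right)
  exact hpq.2 (e1.symm.trans e2)

/-- There is a component of a closed subgroup containing the identity. [folklore] -/
theorem exists_comps_one_mem : ∃ 𝔮 ∈ comps (H : Set (LinGroup d₀ d₁)), (1 : LinGroup d₀ d₁) ∈ zeroSetI (d₀ := d₀) (d₁ := d₁) 𝔮 := by
  have h1 : (1 : LinGroup d₀ d₁) ∈ (H : Set (LinGroup d₀ d₁)) := H.one_mem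
  conv at h1 => rw [hH.eq_biUnion_minimalPrimes]
  simp only [Set.mem_iUnion] at h1
  obtain ⟨𝔮, h𝔮, h1⟩ := h1
  exact ⟨𝔮, h𝔮, h1⟩

/-- The identity component of a closed subgroup, as a set: the component through `e`. [folklore] -/
def idCompSet : Set (LinGroup d₀ d₁) := zeroSetI (d₀ := d₀) (d₁ := d₁) (Classical.choose (exists_comps_one_mem H hH))

/-- The defining property of `idCompSet`. [folklore] -/
theorem idCompSet_spec : Classical.choose (exists_comps_one_mem H hH) ∈ comps (H : Set (LinGroup d₀ d₁)) ∧
    (1 : LinGroup d₀ d₁) ∈ idCompSet H hH :=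
  Classical.choose_spec (exists_comps_one_mem H hH)

/-- The identity component is irreducible closed. [folklore] -/
theorem isIrred_idCompSet : IsIrred (idCompSet H hH) :=
  (isIrred_zeroSet_of_mem_minimalPrimes ((mem_comps).mp (idCompSet_spec H hH).1)).1

/-- The identity component lies in `H`. [folklore] -/
theorem idCompSet_subset : idCompSet H hH ⊆ (H : Set (LinGroup d₀ d₁)) := by
  have := (isIrred_zeroSet_of_mem_minimalPrimes ((mem_comps).mp (idCompSet_spec H hH).1)).2.2
  rwa [hH.eq] at this

/-- A component of `H` containing a point of `h • H₀` is `h • H₀`. [folklore] -/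
theorem smul_idCompSet_eq {h : LinGroup d₀ d₁} (hh : h ∈ H) {𝔮 : Ideal (MvPolynomial (Fin d₀ ⊕ Fin d₁) ℂ)}
    (h𝔮 : 𝔮 ∈ comps (H : Set (LinGroup d₀ d₁))) (hmeet : (h • idCompSet H hH ∩ zeroSetI (d₀ := d₀) (d₁ := d₁) 𝔮).Nonempty) :
    h • idCompSet H hH = zeroSetI 𝔮 := by
  obtain ⟨𝔮', h𝔮', he⟩ := smul_comp_eq_comp H hH (idCompSet_spec H hH).1 hh
  change h • idCompSet H hH = zeroSetI 𝔮' at he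
  rw [he] at hmeet ⊢
  by_contra hne
  have hne' : 𝔮' ≠ 𝔮 := fun heq => hne (heq ▸ rfl)
  exact Set.not_nonempty_iff_eq_empty.mpr (Set.disjoint_iff_inter_eq_empty.mp (comps_disjoint H hH h𝔮' h𝔮 hne'))
    hmeet

/-- `c • H₀ = H₀` for `c ∈ H₀`. [folklore] -/
theorem smul_idCompSet_self {c : LinGroup d₀ d₁} (hc : c ∈ idCompSet H hH) : c • idCompSet H hH = idCompSet H hH :=
  smul_idCompSet_eq H hH (idCompSet_subset H hH hc) (idCompSet_spec H hH).1
    ⟨c, ⟨1, (idCompSet_spec H hH).2, by simp⟩, hc⟩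

/-- **The identity component `H₀` of a closed subgroup `H`** (a closed irreducible subgroup of
finite index whose cosets are the components of `H`). [folklore] -/
def idComp : Subgroup (LinGroup d₀ d₁) where
  carrier := idCompSet H hH
  one_mem' := (idCompSet_spec H hH).2
  mul_mem' := fun {a b} ha hb => by
    have h := smul_idCompSet_self H hH ha
    rw [← h]
    exact Set.smul_mem_smul_set hb
  inv_mem' := fun {a} ha => by
    have h : a⁻¹ • idCompSet H hH = idCompSet H hH :=
      smul_idCompSet_eq H hH (H.inv_mem (idCompSet_subset H hH ha)) (idCompSet_spec H hH).1
        ⟨1, ⟨a, ha, by simp⟩, (idCompSet_spec H hH).2⟩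
    have : a⁻¹ • (1 : LinGroup d₀ d₁) ∈ a⁻¹ • idCompSet H hH := Set.smul_mem_smul_set (idCompSet_spec H hH).2
    rw [h, smul_eq_mul, mul_one] at this
    exact this

/-- The carrier of `idComp`. [folklore] -/
theorem coe_idComp : ((idComp H hH : Subgroup (LinGroup d₀ d₁)) : Set (LinGroup d₀ d₁)) = idCompSet H hH := rfl

/-- `H₀ ≤ H`. [folklore] -/
theorem idComp_le : idComp H hH ≤ H := fun _ hx => idCompSet_subset H hH hx

/-- `H₀` is irreducible closed. [folklore] -/
theorem isIrred_idComp : IsIrred ((idComp H hH : Subgroup (LinGroup d₀ d₁)) : Set (LinGroup d₀ d₁)) := isIrred_idCompSet H hH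

/-- **Finite index**: a closed subgroup is a finite union of cosets of its identity component (one
per component). [folklore] -/
theorem exists_finset_eq_biUnion_smul_idComp :
    ∃ F : Finset (LinGroup d₀ d₁), (↑F : Set (LinGroup d₀ d₁)) ⊆ H ∧
      (H : Set (LinGroup d₀ d₁)) = ⋃ h ∈ F, h • ((idComp H hH : Subgroup (LinGroup d₀ d₁)) : Set (LinGroup d₀ d₁)) := by
  classical
  -- one point in each component
  have hpt : ∀ 𝔮 ∈ comps (H : Set (LinGroup d₀ d₁)), ∃ h : LinGroup d₀ d₁, h ∈ zeroSetI (d₀ := d₀) (d₁ := d₁) 𝔮 := fun 𝔮 h𝔮 =>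
    (isIrred_zeroSet_of_mem_minimalPrimes ((mem_comps).mp h𝔮)).1.nonempty
  choose! pt hpt using hpt
  refine ⟨(comps (H : Set (LinGroup d₀ d₁))).image pt, ?_, ?_⟩
  · intro h hh
    rw [Finset.coe_image] at hh
    obtain ⟨𝔮, h𝔮, rfl⟩ := hh
    have := (isIrred_zeroSet_of_mem_minimalPrimes ((mem_comps).mp h𝔮)).2.2 (hpt 𝔮 h𝔮)
    rwa [hH.eq] at this
  · have hcomp : ∀ 𝔮 ∈ comps (H : Set (LinGroup d₀ d₁)),
        pt 𝔮 • ((idComp H hH : Subgroup (LinGroup d₀ d₁)) : Set (LinGroup d₀ d₁)) = zeroSetI 𝔮 := by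
      intro 𝔮 h𝔮
      have hptH : pt 𝔮 ∈ H := by
        have := (isIrred_zeroSet_of_mem_minimalPrimes ((mem_comps).mp h𝔮)).2.2 (hpt 𝔮 h𝔮)
        rwa [hH.eq] at this
      exact smul_idCompSet_eq H hH hptH h𝔮 ⟨pt 𝔮, ⟨1, (idCompSet_spec H hH).2, by simp⟩, hpt 𝔮 h𝔮⟩
    conv_lhs => rw [hH.eq_biUnion_minimalPrimes]
    ext g
    simp only [Set.mem_iUnion, Finset.mem_image, exists_prop]
    constructor
    · rintro ⟨𝔮, h𝔮, hg⟩
      refine ⟨pt 𝔮, ⟨𝔮, h𝔮, rfl⟩, ?_⟩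
      rw [hcomp 𝔮 h𝔮]; exact hg
    · rintro ⟨_, ⟨𝔮, h𝔮, rfl⟩, hg⟩
      refine ⟨𝔮, h𝔮, ?_⟩
      rw [hcomp 𝔮 h𝔮] at hg; exact hg

end ClosedSubgroup

/-! ### Characters, monomial values, and evaluation through monomials -/

/-- The characters `χ ∈ ℤ^{d₁}` of the torus that are trivial on (the torus coordinates of the
points of) `X`. [folklore] -/
def charGroup (X : Set (LinGroup d₀ d₁)) : AddSubgroup (Fin d₁ → ℤ) where
  carrier := {χ | ∀ h ∈ X, ∏ j, (h.2 j) ^ (χ j) = 1}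
  zero_mem' := fun h _ => by simp
  add_mem' := fun {χ χ'} hχ hχ' h hh => by
    simp only [Pi.add_apply, zpow_add, Finset.prod_mul_distrib, hχ h hh, hχ' h hh, mul_one]
  neg_mem' := fun {χ} hχ h hh => by
    simp only [Pi.neg_apply, zpow_neg, Finset.prod_inv_distrib, hχ h hh, inv_one]

/-- Membership in `charGroup`. [folklore] -/
theorem mem_charGroup_iff {X : Set (LinGroup d₀ d₁)} {χ : Fin d₁ → ℤ} :
    χ ∈ charGroup X ↔ ∀ h ∈ X, ∏ j, (h.2 j) ^ (χ j) = 1 := Iff.rfl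

/-- The monomial character `h ↦ h₂^{s'}` of a subgroup, for an exponent `s`. [folklore] -/
def monChar (K : Subgroup (LinGroup d₀ d₁)) (s : (Fin d₀ ⊕ Fin d₁) →₀ ℕ) : ↥K →* ℂ where
  toFun h := charVal (h : LinGroup d₀ d₁).2 s
  map_one' := by simp [charVal]
  map_mul' a b := by
    simp only [charVal, Subgroup.coe_mul, Prod.snd_mul, Pi.mul_apply, Units.val_mul, mul_pow,
      Finset.prod_mul_distrib]

/-- Unfolding `monChar`. [folklore] -/
theorem monChar_apply (K : Subgroup (LinGroup d₀ d₁)) (s : (Fin d₀ ⊕ Fin d₁) →₀ ℕ) (h : ↥K) :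
    monChar K s h = charVal (h : LinGroup d₀ d₁).2 s := rfl

/-- `charVal` through units. [folklore] -/
theorem charVal_eq_coe (y : Fin d₁ → ℂˣ) (s : (Fin d₀ ⊕ Fin d₁) →₀ ℕ) :
    charVal y s = ((∏ j, (y j) ^ (s (Sum.inr j)) : ℂˣ) : ℂ) := by
  simp [charVal]

/-- The value of the additive monomial `X^{s₀}` at `x ∈ ℂ^{d₀}`. [folklore] -/
def addVal (x : Fin d₀ → ℂ) (s : (Fin d₀ ⊕ Fin d₁) →₀ ℕ) : ℂ := ∏ i : Fin d₀, x i ^ s (Sum.inl i)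

/-- `addVal 0 s = 1` if `s` has no additive part, `0` otherwise. [folklore] -/
theorem addVal_zero (s : (Fin d₀ ⊕ Fin d₁) →₀ ℕ) :
    addVal (d₁ := d₁) (0 : Fin d₀ → ℂ) s = if ∀ i, s (Sum.inl i) = 0 then 1 else 0 := by
  classical
  unfold addVal
  split_ifs with h
  · exact Finset.prod_eq_one fun i _ => by rw [h i, pow_zero]
  · push Not at h
    obtain ⟨i, hi⟩ := h
    exact Finset.prod_eq_zero (Finset.mem_univ i) (by rw [Pi.zero_apply, zero_pow hi])

/-- Evaluation of a polynomial at a point of `G(ℂ)` through its monomials: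
`P(x, y) = ∑_s c_s x^{s₀} y^{s'}`. [folklore] -/
theorem evalAt_eq_sum (P : MvPolynomial (Fin d₀ ⊕ Fin d₁) ℂ) (g : LinGroup d₀ d₁) :
    evalAt P g = ∑ s ∈ P.support, P.coeff s * (addVal (Multiplicative.toAdd g.1) s * charVal g.2 s) := by
  classical
  rw [evalAt_eq_eval]
  change MvPolynomial.eval₂ (RingHom.id ℂ) (coord g) P = _
  rw [MvPolynomial.eval₂_eq']
  refine Finset.sum_congr rfl fun s _ => ?_
  rw [RingHom.id_apply, Fintype.prod_sum_type]
  simp [coord, charVal, addVal]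

/-- If two exponents give the same character of `K`, their difference is a character trivial on
`K`. [folklore] -/
theorem sub_mem_charGroup_of_monChar_eq {K : Subgroup (LinGroup d₀ d₁)} {s s' : (Fin d₀ ⊕ Fin d₁) →₀ ℕ}
    (h : monChar K s = monChar K s') :
    (fun j => (s' (Sum.inr j) : ℤ) - s (Sum.inr j)) ∈ charGroup (K : Set (LinGroup d₀ d₁)) := by
  intro k hk
  have h1 := congrArg (fun f : ↥K →* ℂ => f ⟨k, hk⟩) h
  simp only [monChar_apply, charVal_eq_coe] at h1
  have h2 : (∏ j, (k.2 j) ^ (s (Sum.inr j)) : ℂˣ) = ∏ j, (k.2 j) ^ (s' (Sum.inr j)) := Units.val_injective h1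
  simp only [zpow_sub, zpow_natCast]
  rw [Finset.prod_mul_distrib, Finset.prod_inv_distrib, ← h2, mul_inv_cancel]

/-- Values of monomials at `y` are constant on the classes of exponents modulo characters
satisfied by `y`. [folklore] -/
theorem charVal_eq_of_sub_mem {y : Fin d₁ → ℂˣ} {A : AddSubgroup (Fin d₁ → ℤ)}
    (hy : ∀ χ ∈ A, ∏ j, (y j) ^ (χ j) = 1) {s s' : (Fin d₀ ⊕ Fin d₁) →₀ ℕ}
    (h : (fun j => (s' (Sum.inr j) : ℤ) - s (Sum.inr j)) ∈ A) : charVal y s = charVal y s' := by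
  have h1 := hy _ h
  simp only [zpow_sub, zpow_natCast] at h1
  rw [Finset.prod_mul_distrib, Finset.prod_inv_distrib, mul_inv_eq_one] at h1
  rw [charVal_eq_coe, charVal_eq_coe, h1]

/-- The zero set in `G(ℂ)` of `Y^{χ⁺} - ζ Y^{χ⁻}` is `{y^χ = ζ}`. [folklore] -/
theorem evalAt_charPoly_eq_zero_iff (χ : Fin d₁ → ℤ) (ζ : ℂˣ) (g : LinGroup d₀ d₁) :
    evalAt (∏ j, X (Sum.inr j) ^ (χ j).toNat - C (ζ : ℂ) * ∏ j, X (Sum.inr j) ^ (-χ j).toNat :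
      MvPolynomial (Fin d₀ ⊕ Fin d₁) ℂ) g = 0 ↔ ∏ j, (g.2 j) ^ (χ j) = ζ := by
  rw [evalAt_eq_eval]
  simp only [map_sub, map_mul, map_prod, map_pow, MvPolynomial.eval_X, MvPolynomial.eval_C, coord_inr,
    sub_eq_zero]
  -- `∏ y^{χ⁺} = ζ ∏ y^{χ⁻}` in `ℂ` iff `∏ y^χ = ζ` in `ℂˣ`
  have key : (∏ j, (g.2 j) ^ (χ j) : ℂˣ) = (∏ j, (g.2 j) ^ (χ j).toNat) / ∏ j, (g.2 j) ^ (-χ j).toNat := by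
    rw [← Finset.prod_div_distrib]
    refine Finset.prod_congr rfl fun j _ => ?_
    rw [← zpow_natCast, ← zpow_natCast, div_eq_mul_inv, ← zpow_neg, ← zpow_add]
    congr 1
    omega
  rw [key, div_eq_iff_eq_mul']
  constructor
  · intro h
    apply Units.val_injective
    push_cast
    rw [h, mul_comm]
  · intro h
    have := congrArg (fun u : ℂˣ => (u : ℂ)) h
    push_cast at this
    rw [this, mul_comm]

section Structure

variable (H : Subgroup (LinGroup d₀ d₁))

/-! ### The additive part of a closed subgroup is a vector subspace -/

/-- Additive points of `H` multiply: `(x, 1)(x', 1) = (x + x', 1)`. [folklore] -/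
theorem addElt_mul (x x' : Fin d₀ → ℂ) :
    ((Multiplicative.ofAdd x, (1 : Fin d₁ → ℂˣ)) : LinGroup d₀ d₁) * (Multiplicative.ofAdd x', 1) =
      (Multiplicative.ofAdd (x + x'), 1) := by
  rw [Prod.mk_mul_mk, mul_one, ofAdd_add]

/-- **The additive points of a closed subgroup are stable under `ℂ`**: if `(x, 1) ∈ H` then
`(cx, 1) ∈ H` for every `c ∈ ℂ` — a polynomial of `𝔍(H)` restricted to the line `t ↦ (tx, 1)`
is a univariate polynomial vanishing on `ℕ`, hence everywhere. (For `d₀ = 1` this is the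
dichotomy "the additive part is `0` or `ℂ`".) [folklore] -/
theorem smul_mem_of_add_mem (hH : IsClosedG (H : Set (LinGroup d₀ d₁))) {x : Fin d₀ → ℂ}
    (hx : ((Multiplicative.ofAdd x, (1 : Fin d₁ → ℂˣ)) : LinGroup d₀ d₁) ∈ H) (c : ℂ) :
    ((Multiplicative.ofAdd (c • x), (1 : Fin d₁ → ℂˣ)) : LinGroup d₀ d₁) ∈ H := by
  classical
  suffices h : ∀ P ∈ vanishing (H : Set (LinGroup d₀ d₁)),
      evalAt P ((Multiplicative.ofAdd (c • x), (1 : Fin d₁ → ℂˣ)) : LinGroup d₀ d₁) = 0 by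
    have : ((Multiplicative.ofAdd (c • x), (1 : Fin d₁ → ℂˣ)) : LinGroup d₀ d₁) ∈
        zeroSet (d₀ := d₀) (d₁ := d₁) ↑(vanishing (H : Set (LinGroup d₀ d₁))) := fun P hP => h P hP
    rwa [hH.eq] at this
  intro P hP
  -- the restriction of `P` to the line `t ↦ (tx, 1)`
  set f : Fin d₀ ⊕ Fin d₁ → Polynomial ℂ :=
    Sum.elim (fun i => Polynomial.C (x i) * Polynomial.X) (fun _ => 1) with hf
  set p : Polynomial ℂ := MvPolynomial.aeval f P with hp
  have hpev : ∀ t : ℂ, p.eval t = evalAt P ((Multiplicative.ofAdd (t • x), (1 : Fin d₁ → ℂˣ)) : LinGroup d₀ d₁) := by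
    intro t
    have hfun : (fun v => Polynomial.aeval t (f v)) =
        coord ((Multiplicative.ofAdd (t • x), (1 : Fin d₁ → ℂˣ)) : LinGroup d₀ d₁) := by
      funext v
      rcases v with i | l
      · rw [hf, Sum.elim_inl, map_mul, Polynomial.aeval_C, Polynomial.aeval_X, Algebra.algebraMap_self_apply,
          coord_inl, toAdd_ofAdd, Pi.smul_apply, smul_eq_mul, mul_comm]
      · rw [hf, Sum.elim_inr, map_one, coord_inr]
        simp
    rw [show p.eval t = Polynomial.aeval t p from (congrFun (Polynomial.coe_aeval_eq_eval t) p).symm, hp,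
      ← AlgHom.comp_apply, MvPolynomial.comp_aeval, hfun, evalAt_eq_eval]
    rfl
  -- `p` vanishes on `ℕ`, hence `p = 0`
  have hroot : ∀ k : ℕ, p.IsRoot (k : ℂ) := by
    intro k
    rw [Polynomial.IsRoot.def, hpev]
    have hmem : ((Multiplicative.ofAdd ((k : ℂ) • x), (1 : Fin d₁ → ℂˣ)) : LinGroup d₀ d₁) ∈ H := by
      have : ((Multiplicative.ofAdd ((k : ℂ) • x), (1 : Fin d₁ → ℂˣ)) : LinGroup d₀ d₁) =
          ((Multiplicative.ofAdd x, (1 : Fin d₁ → ℂˣ)) : LinGroup d₀ d₁) ^ k := by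
        ext <;> simp [← ofAdd_nsmul, Nat.cast_smul_eq_nsmul]
      rw [this]; exact H.pow_mem hx k
    exact hP _ hmem
  have hp0 : p = 0 := by
    refine Polynomial.eq_zero_of_infinite_isRoot p ?_
    refine Set.Infinite.mono (s := Set.range (fun k : ℕ => (k : ℂ))) ?_ (Set.infinite_range_of_injective Nat.cast_injective)
    rintro _ ⟨k, rfl⟩
    exact hroot k
  rw [← hpev, hp0, Polynomial.eval_zero]

/-- **The additive part of a closed subgroup**: the `ℂ`-subspace `E = {x ; (x, 1) ∈ H}` of `ℂ^{d₀}`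
(a subgroup by the group law, stable under `ℂ` by `smul_mem_of_add_mem`). [folklore] -/
def addSubspace (hH : IsClosedG (H : Set (LinGroup d₀ d₁))) : Submodule ℂ (Fin d₀ → ℂ) where
  carrier := {x | ((Multiplicative.ofAdd x, (1 : Fin d₁ → ℂˣ)) : LinGroup d₀ d₁) ∈ H}
  zero_mem' := by
    change ((Multiplicative.ofAdd (0 : Fin d₀ → ℂ), (1 : Fin d₁ → ℂˣ)) : LinGroup d₀ d₁) ∈ H
    rw [ofAdd_zero]
    exact H.one_mem
  add_mem' := fun {x x'} hx hx' => by
    change ((Multiplicative.ofAdd (x + x'), (1 : Fin d₁ → ℂˣ)) : LinGroup d₀ d₁) ∈ H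
    rw [← addElt_mul]
    exact H.mul_mem hx hx'
  smul_mem' := fun c x hx => smul_mem_of_add_mem H hH hx c

/-- Membership in the additive part. [folklore] -/
theorem mem_addSubspace_iff (hH : IsClosedG (H : Set (LinGroup d₀ d₁))) (x : Fin d₀ → ℂ) :
    x ∈ addSubspace H hH ↔ ((Multiplicative.ofAdd x, (1 : Fin d₁ → ℂˣ)) : LinGroup d₀ d₁) ∈ H := Iff.rfl

/-! ### Duality for closed subgroups -/

/-- **Duality for closed subgroups**: a torus point satisfying all the characters trivial on a
closed subgroup `H` lies in `H`. (Proof: restrict `P ∈ 𝔍(H)` to the torus points of `H`, group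
its monomials by the character of `H` they induce, apply Artin's independence of characters.)
[folklore] -/
theorem mem_of_charGroup (hH : IsClosedG (H : Set (LinGroup d₀ d₁))) {y : Fin d₁ → ℂˣ}
    (hy : ∀ χ ∈ charGroup (H : Set (LinGroup d₀ d₁)), ∏ j, (y j) ^ (χ j) = 1) :
    ((1 : Multiplicative (Fin d₀ → ℂ)), y) ∈ H := by
  classical
  suffices h : ∀ P ∈ vanishing (H : Set (LinGroup d₀ d₁)), evalAt P ((1 : Multiplicative (Fin d₀ → ℂ)), y) = 0 by
    have : ((1 : Multiplicative (Fin d₀ → ℂ)), y) ∈ zeroSet (d₀ := d₀) (d₁ := d₁) ↑(vanishing (H : Set (LinGroup d₀ d₁))) :=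
      fun P hP => h P hP
    rwa [hH.eq] at this
  intro P hP
  -- the torus points of `H`
  let Hs : Subgroup (LinGroup d₀ d₁) :=
    { carrier := {h | h ∈ H ∧ h.1 = 1}
      one_mem' := ⟨H.one_mem, rfl⟩
      mul_mem' := fun {a b} ha hb => ⟨H.mul_mem ha.1 hb.1, by rw [Prod.fst_mul, ha.2, hb.2, one_mul]⟩
      inv_mem' := fun {a} ha => ⟨H.inv_mem ha.1, by rw [Prod.fst_inv, ha.2, inv_one]⟩ }
  have hHs_char : charGroup ((Hs : Subgroup (LinGroup d₀ d₁)) : Set (LinGroup d₀ d₁)) = charGroup (H : Set (LinGroup d₀ d₁)) := by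
    ext χ
    simp only [mem_charGroup_iff]
    constructor
    · intro h k hk
      exact h ((1 : Multiplicative (Fin d₀ → ℂ)), k.2) ⟨torusPart_mem H hH hk, rfl⟩
    · intro h k hk
      exact h k hk.1
  -- the exponents with no additive part and their characters
  set Sup := P.support.filter (fun s => ∀ i, s (Sum.inl i) = 0) with hSup
  set Φ : ((Fin d₀ ⊕ Fin d₁) →₀ ℕ) → (↥Hs →* ℂ) := monChar Hs with hΦ
  -- `P` restricted to `Hs` is `∑_{s ∈ Sup} c_s Φ(s)`
  have hPres : ∀ k : ↥Hs, ∑ s ∈ Sup, P.coeff s * Φ s k = 0 := by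
    intro k
    have h0 := hP (k : LinGroup d₀ d₁) k.2.1
    rw [evalAt_eq_sum] at h0
    rw [← h0, hSup, Finset.sum_filter]
    refine Finset.sum_congr rfl fun s _ => ?_
    have hk1 : Multiplicative.toAdd (k : LinGroup d₀ d₁).1 = 0 := by rw [k.2.2]; rfl
    rw [hk1, addVal_zero]
    split_ifs with hs0
    · rw [hΦ, monChar_apply, one_mul]
    · rw [zero_mul, mul_zero]
  -- group by characters: the coefficient of each character vanishes (Artin)
  set T := Sup.image Φ with hT
  set a : (↥Hs →* ℂ) → ℂ := fun φ => ∑ s ∈ Sup.filter (fun s => Φ s = φ), P.coeff s with ha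
  have hmaps : ∀ s ∈ Sup, Φ s ∈ T := fun s hs => Finset.mem_image_of_mem _ hs
  have hsum : ∑ φ ∈ T, a φ • (fun f : ↥Hs →* ℂ => (f : ↥Hs → ℂ)) φ = 0 := by
    funext k
    rw [Finset.sum_apply, Pi.zero_apply]
    simp only [Pi.smul_apply, smul_eq_mul]
    have : ∑ φ ∈ T, a φ * φ k = ∑ s ∈ Sup, P.coeff s * Φ s k := by
      rw [← Finset.sum_fiberwise_of_maps_to hmaps (fun s => P.coeff s * Φ s k)]
      refine Finset.sum_congr rfl fun φ _ => ?_
      rw [ha, Finset.sum_mul]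
      refine Finset.sum_congr rfl fun s hs => ?_
      rw [(Finset.mem_filter.mp hs).2]
    rw [this, hPres k]
  have hli := linearIndependent_monoidHom (↥Hs) ℂ
  have ha0 : ∀ φ ∈ T, a φ = 0 := fun φ hφ => linearIndependent_iff'.mp hli T a hsum φ hφ
  -- evaluate at `(0, y)`: within a class the monomial values coincide
  rw [evalAt_eq_sum]
  have hval : ∀ s s' : (Fin d₀ ⊕ Fin d₁) →₀ ℕ, Φ s = Φ s' → charVal y s = charVal y s' := by
    intro s s' hss'
    refine charVal_eq_of_sub_mem hy ?_
    rw [← hHs_char]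
    exact sub_mem_charGroup_of_monChar_eq hss'
  calc ∑ s ∈ P.support, P.coeff s * (addVal (Multiplicative.toAdd (1 : Multiplicative (Fin d₀ → ℂ))) s * charVal y s)
      = ∑ s ∈ Sup, P.coeff s * charVal y s := by
        rw [hSup, Finset.sum_filter]
        refine Finset.sum_congr rfl fun s _ => ?_
        rw [toAdd_one, addVal_zero]
        split_ifs with hs0
        · rw [one_mul]
        · rw [zero_mul, mul_zero]
    _ = ∑ φ ∈ T, ∑ s ∈ Sup.filter (fun s => Φ s = φ), P.coeff s * charVal y s :=
        (Finset.sum_fiberwise_of_maps_to hmaps _).symm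
    _ = ∑ φ ∈ T, 0 := by
        refine Finset.sum_congr rfl fun φ hφ => ?_
        rw [hT, Finset.mem_image] at hφ
        obtain ⟨s₀, hs₀, rfl⟩ := hφ
        have : ∀ s ∈ Sup.filter (fun s => Φ s = Φ s₀), P.coeff s * charVal y s = P.coeff s * charVal y s₀ := by
          intro s hs
          rw [hval s s₀ (Finset.mem_filter.mp hs).2]
        rw [Finset.sum_congr rfl this, ← Finset.sum_mul]
        have h0 := ha0 (Φ s₀) (Finset.mem_image_of_mem _ hs₀)
        simp only [ha] at h0
        rw [h0, zero_mul]
    _ = 0 := Finset.sum_const_zero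

/-! ### Saturation of the character group of an irreducible closed subgroup -/

/-- **Saturation.** The character group of an irreducible closed subgroup is saturated: `kχ`
trivial on `H`, `k ≠ 0`, forces `χ` trivial on `H` (`H` is covered by the finitely many closed
level sets `{y^χ = ζ}`, `ζ^{|k|} = 1`, and contains `e`). [folklore] -/
theorem charGroup_saturated (hirr : IsIrred (H : Set (LinGroup d₀ d₁))) {k : ℤ} {χ : Fin d₁ → ℤ} (hk : k ≠ 0)
    (hkχ : k • χ ∈ charGroup (H : Set (LinGroup d₀ d₁))) : χ ∈ charGroup (H : Set (LinGroup d₀ d₁)) := by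
  classical
  -- the character `ψ = y^χ` takes values in the `|k|`-th roots of unity on `H`
  set m := k.natAbs with hm
  have hm0 : 0 < m := Int.natAbs_pos.mpr hk
  haveI : NeZero m := ⟨hm0.ne'⟩
  have hpow : ∀ h ∈ H, (∏ j, (h.2 j) ^ (χ j)) ^ m = 1 := by
    intro h hh
    have h1 : ∀ l : ℤ, l • χ ∈ charGroup (H : Set (LinGroup d₀ d₁)) → (∏ j, (h.2 j) ^ (χ j)) ^ l = 1 := by
      intro l hl
      have := hl h hh
      simp only [Pi.smul_apply, smul_eq_mul] at this
      rw [← this, ← Finset.prod_zpow]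
      refine Finset.prod_congr rfl fun j _ => ?_
      rw [← zpow_mul, mul_comm]
    rcases Int.natAbs_eq k with hk' | hk'
    · have := h1 k hkχ
      rw [hk'] at this
      exact_mod_cast this
    · have := h1 (-k) (by simpa using (charGroup (H : Set (LinGroup d₀ d₁))).neg_mem hkχ)
      rw [hk', neg_neg] at this
      exact_mod_cast this
  -- the level sets
  haveI : Fintype ↥(rootsOfUnity m ℂ) := Fintype.ofFinite _
  set roots : Finset ℂˣ := (Finset.univ : Finset ↥(rootsOfUnity m ℂ)).image
    (fun ζ : ↥(rootsOfUnity m ℂ) => (ζ.1 : ℂˣ)) with hroots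
  have hcover : (H : Set (LinGroup d₀ d₁)) ⊆ ⋃ ζ ∈ roots, ((H : Set (LinGroup d₀ d₁)) ∩
      zeroSet {(∏ j, X (Sum.inr j) ^ (χ j).toNat - C (ζ : ℂ) * ∏ j, X (Sum.inr j) ^ (-χ j).toNat :
        MvPolynomial (Fin d₀ ⊕ Fin d₁) ℂ)}) := by
    intro h hh
    rw [Set.mem_iUnion₂]
    have hu : (∏ j, (h.2 j) ^ (χ j)) ∈ rootsOfUnity m ℂ := by
      rw [mem_rootsOfUnity]; exact hpow h hh
    refine ⟨∏ j, (h.2 j) ^ (χ j), ?_, hh, fun Q hQ => ?_⟩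
    · rw [hroots, Finset.mem_image]
      exact ⟨(⟨∏ j, (h.2 j) ^ (χ j), hu⟩ : ↥(rootsOfUnity m ℂ)), Finset.mem_univ _, rfl⟩
    · rw [Set.mem_singleton_iff.mp hQ, evalAt_charPoly_eq_zero_iff]
  obtain ⟨ζ, _, hle⟩ := hirr.exists_subset_of_subset_biUnion roots _
    (fun ζ _ => hirr.isClosedG.inter (isClosedG_zeroSet _)) hcover
  -- `e ∈ H` forces `ζ = 1`
  have hζ1 : ζ = 1 := by
    have h1 := (hle H.one_mem).2 _ rfl
    rw [evalAt_charPoly_eq_zero_iff] at h1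
    simpa using h1.symm
  subst hζ1
  intro h hh
  have := (hle hh).2 _ rfl
  rwa [evalAt_charPoly_eq_zero_iff] at this

/-! ### Irreducible closed subgroups are the `E × T_A` of `ConnAlgSubgroup` -/

/-- The `ConnAlgSubgroup` structure (`E × T_A`) of an irreducible closed subgroup `H`:
`E = {x ; (x, 1) ∈ H}` its additive part, `A =` the characters trivial on `H`. [folklore] -/
def toConnAlgSubgroup (hirr : IsIrred (H : Set (LinGroup d₀ d₁))) : ConnAlgSubgroup d₀ d₁ where
  addPart := addSubspace H hirr.isClosedG
  chars := charGroup (H : Set (LinGroup d₀ d₁))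
  saturated := fun _ _ hk h => charGroup_saturated H hirr hk h

/-- The character lattice of `toConnAlgSubgroup`. [folklore] -/
theorem toConnAlgSubgroup_chars (hirr : IsIrred (H : Set (LinGroup d₀ d₁))) :
    (toConnAlgSubgroup H hirr).chars = charGroup (H : Set (LinGroup d₀ d₁)) := rfl

/-- The additive part of `toConnAlgSubgroup`. [folklore] -/
theorem toConnAlgSubgroup_addPart (hirr : IsIrred (H : Set (LinGroup d₀ d₁))) :
    (toConnAlgSubgroup H hirr).addPart = addSubspace H hirr.isClosedG := rfl

/-- **Structure theorem.** An irreducible closed subgroup of `ℂ^{d₀} × (ℂˣ)^{d₁}` is the group of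
points of the connected algebraic subgroup `E × T_A` attached to it. [folklore] -/
theorem toSubgroup_toConnAlgSubgroup (hirr : IsIrred (H : Set (LinGroup d₀ d₁))) :
    (toConnAlgSubgroup H hirr).toSubgroup = H := by
  classical
  have hcl : IsClosedG (H : Set (LinGroup d₀ d₁)) := hirr.isClosedG
  ext g
  rw [ConnAlgSubgroup.mem_toSubgroup_iff, toConnAlgSubgroup_chars, toConnAlgSubgroup_addPart, mem_addSubspace_iff,
    ofAdd_toAdd]
  constructor
  · rintro ⟨hadd, hch⟩
    have hs : ((1 : Multiplicative (Fin d₀ → ℂ)), g.2) ∈ H := mem_of_charGroup H hcl hch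
    have : g = (g.1, (1 : Fin d₁ → ℂˣ)) * ((1 : Multiplicative (Fin d₀ → ℂ)), g.2) := by ext <;> simp
    rw [this]; exact H.mul_mem hadd hs
  · intro hg
    refine ⟨?_, fun χ hχ => hχ g hg⟩
    have hs := torusPart_mem H hcl hg
    have : (g.1, (1 : Fin d₁ → ℂˣ)) = g * ((1 : Multiplicative (Fin d₀ → ℂ)), g.2)⁻¹ := by ext <;> simp
    rw [this]; exact H.mul_mem hg (H.inv_mem hs)

end Structure

end LinGroup

end Literature.NumberTheory.Transcendental
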